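import Summits.Ventures.LatticeQCDFlow.Exactness.AcceptanceFromMeanEnergyViolation
import Summits.Ventures.LatticeQCDFlow.Exactness.NCMCGeneralSpacePinskerFloor
import Summits.Ventures.LatticeQCDFlow.Exactness.Phi4HMCEnergyViolationIntegrable
import HarnessLib

/-!
# Acceptance from the mean energy violation, Pinsker form: `1 − ⟨P_acc⟩ ≤ √(⟨ΔH⟩/2)` for every
# volume-preserving reversible proposal — row 2's HMC in particular

HONEST FRAMING: exact (Metropolis-corrected) sampling algorithms for lattice gauge theory;
figures of merit are autocorrelation/cost numbers at stated couplings and volumes; no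
continuum-physics claim.  (SCALAR calibration rung S0-A: not a gauge result.)

Venture `LatticeQCDFlow` (cell pub-lqcd), topic `Exactness`; FANOUT row 2 (`s0-phi4`: the HMC arm of
the 2D φ⁴ calibration — the acceptance and `dH` columns of the exactness battery).  NEW WORK of the
cell assembled from tree theorems (nothing is cited as a fact; Pinsker 1964 / Csiszár 1967 NAMED):
row 2's `AcceptanceFromMeanEnergyViolation` gave the Bretagnolle–Huber floor
`1 − ⟨P_acc⟩ ≤ √(1 − e^{−⟨ΔH⟩}) ≤ √⟨ΔH⟩` from Creutz's identity; row 13's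
`NCMCGeneralSpacePinskerFloor.sq_integral_abs_one_sub_le` is Pinsker in density form
(`(∫ |1 − d|)² ≤ 2 ∫ d log d` on a probability space).  With `d = e^{−ΔH}` and the FLUCTUATION
RELATION of `Phi4HMCFluctuationRelation` (`∫ g(ΔH) e^{−H} = ∫ g(−ΔH) e^{−ΔH} e^{−H}`, here `g = id`:
`∫ d log d · e^{−H} = ∫ ΔH e^{−H}`) this gives the sharper floor
**`1 − ⟨P_acc⟩ ≤ √(⟨ΔH⟩/2)`** — better than `√⟨ΔH⟩` by `√2` always, and better than Bretagnolle–Huber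
exactly when `⟨ΔH⟩/2 < 1 − e^{−⟨ΔH⟩}` (`⟨ΔH⟩ < 1.59…`, the whole tuned regime; typed below for
`⟨ΔH⟩ ≤ 1`).

## What is proved

* §1 (any probability space `(X, π)`, any measurable `D` with `e^{−D}`, `D e^{−D}` integrable and
  `∫ e^{−D} dπ = 1`): **`one_sub_acceptance_le_sqrt_half_tilted`** —
  `1 − ∫ min(1, e^{−D}) dπ ≤ √(½ ∫ (−D) e^{−D} dπ)` (Pinsker against the TILTED law `e^{−D} π`);
  `bhFloor_le_pinskerFloor` — `1 − √(1 − e^{−x}) ≤ 1 − √(x/2)` on `[0, 1]` (the Pinsker floor dominates the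
  Bretagnolle–Huber floor there).
* §2 (`(X, μ)`, `Ψ` a measurable `μ`-preserving involution, weight `e^{−H}`, `Z = ∫ e^{−H}`,
  `ΔH = deltaH H Ψ`, `ΔH e^{−H} ∈ L¹`): `integrable_deltaH_tilted` (`(−ΔH) e^{−ΔH} e^{−H} ∈ L¹`, by
  measure preservation), `integral_deltaH_tilted` (`∫ (−ΔH) e^{−ΔH} e^{−H} = ∫ ΔH e^{−H}`, the
  fluctuation relation), **`involutive_acceptance_ge_pinsker`** —
  `∫ min(1, e^{−ΔH}) e^{−H} dμ ≥ (1 − √(⟨ΔH⟩/2)) · Z`, `⟨ΔH⟩ = Z⁻¹ ∫ ΔH e^{−H}`.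
* §3 row 2's lattice HMC (leapfrog, every step size `δ`, trajectory length `N`; coercive action):
  **`hmc_acceptance_ge_pinsker`**, **`hmc_acceptance_ge_pinsker_phi4`** (every `λ > 0`, real `J`)
  — unconditional, the first moment of `ΔH` being integrable (`Phi4HMCEnergyViolationIntegrable`).

Reading for S0-A (no numerics implied): the measured mean energy violation certifies the
acceptance column from below, `⟨P_acc⟩ ≥ 1 − √(⟨ΔH⟩/2)`, with no Gaussian model of `ΔH`; e.g. a
run reporting `⟨ΔH⟩` cannot report an acceptance below this floor without one of the two columns
being wrong (a battery cross-check).  NOT CLAIMED: the Gaussian-model value `erfc(½√⟨ΔH⟩)`; any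
value for any run; anything for the flow / local arms.
-/

namespace Summit.Ventures.LatticeQCDFlow.Exactness

open Real MeasureTheory Filter
open Summit.Ventures.LatticeQCDFlow.Exactness.GeneralNCMC

/-! ## §1 Probability space: Pinsker against the tilted law -/

section Probability

variable {X : Type*} [MeasurableSpace X] {ν : Measure X} [IsProbabilityMeasure ν] {D : X → ℝ}

/-- **`1 − ∫ min(1, e^{−D}) dπ ≤ √(½ ∫ (−D) e^{−D} dπ)`** — Pinsker's inequality between `π` and the
tilted probability `e^{−D} π` (Creutz: `∫ e^{−D} dπ = 1`), whose relative entropy is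
`∫ e^{−D} log e^{−D} dπ = ∫ (−D) e^{−D} dπ`; the acceptance defect is the total variation
`½ ∫ |1 − e^{−D}| dπ`. -/
theorem one_sub_acceptance_le_sqrt_half_tilted (hDm : Measurable D)
    (hE : Integrable (fun x => Real.exp (-D x)) ν)
    (hDE : Integrable (fun x => -D x * Real.exp (-D x)) ν)
    (hcreutz : ∫ x, Real.exp (-D x) ∂ν = 1) :
    1 - ∫ x, min 1 (Real.exp (-D x)) ∂ν
      ≤ Real.sqrt ((∫ x, -D x * Real.exp (-D x) ∂ν) / 2) := by
  rw [one_sub_integral_min_eq_half_integral_abs hDm hE hcreutz]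
  have hdlog : Integrable (fun x => Real.exp (-D x) * Real.log (Real.exp (-D x))) ν :=
    hDE.congr (Eventually.of_forall fun x => by simp only [Real.log_exp]; ring)
  have hP := sq_integral_abs_one_sub_le (μ := ν) (fun x => (Real.exp_pos _).le) hE hcreutz hdlog
  have e : ∫ x, Real.exp (-D x) * Real.log (Real.exp (-D x)) ∂ν = ∫ x, -D x * Real.exp (-D x) ∂ν :=
    integral_congr_ae (Eventually.of_forall fun x => by simp only [Real.log_exp]; ring)
  rw [e] at hP
  set T : ℝ := ∫ x, |1 - Real.exp (-D x)| ∂ν with hT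
  set K : ℝ := ∫ x, -D x * Real.exp (-D x) ∂ν with hK
  have hT0 : 0 ≤ T := integral_nonneg fun x => abs_nonneg _
  -- `T² ≤ 2K` ⇒ `T/2 ≤ √(K/2)`
  have hK0 : 0 ≤ K := by nlinarith [sq_nonneg T]
  have h1 : (1 / 2 * T) ^ 2 ≤ K / 2 := by nlinarith
  calc 1 / 2 * T = Real.sqrt ((1 / 2 * T) ^ 2) := by
        rw [Real.sqrt_sq (by positivity)]
    _ ≤ Real.sqrt (K / 2) := Real.sqrt_le_sqrt h1

/-- **The Pinsker floor dominates the Bretagnolle–Huber floor on `⟨ΔH⟩ ≤ 1`**: for `0 ≤ x ≤ 1`,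
`1 − √(1 − e^{−x}) ≤ 1 − √(x/2)` (i.e. `x/2 ≤ 1 − e^{−x}`, from `e^{x} ≥ (1 + x/2)²`). -/
theorem bhFloor_le_pinskerFloor {x : ℝ} (hx0 : 0 ≤ x) (hx1 : x ≤ 1) :
    1 - Real.sqrt (1 - Real.exp (-x)) ≤ 1 - Real.sqrt (x / 2) := by
  -- `e^{x} = (e^{x/2})² ≥ (1 + x/2)²`, and `(1 − x/2)(1 + x/2)² ≥ 1` on `[0, 1]`
  have h1 : 1 + x / 2 ≤ Real.exp (x / 2) := by
    have := Real.add_one_le_exp (x / 2); linarith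
  have h2 : (1 + x / 2) ^ 2 ≤ Real.exp x := by
    have e : Real.exp x = Real.exp (x / 2) ^ 2 := by
      rw [sq, ← Real.exp_add]; congr 1; ring
    rw [e]
    exact pow_le_pow_left₀ (by linarith) h1 2
  have hpos : 0 < Real.exp x := Real.exp_pos x
  have h3 : 1 ≤ (1 - x / 2) * Real.exp x := by
    have h4 : 1 ≤ (1 - x / 2) * (1 + x / 2) ^ 2 := by
      have key : (1 - x / 2) * (1 + x / 2) ^ 2 - 1 = x / 8 * (4 - 2 * x - x ^ 2) := by ring
      have hq : 0 ≤ 4 - 2 * x - x ^ 2 := by nlinarith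
      have : 0 ≤ x / 8 * (4 - 2 * x - x ^ 2) := mul_nonneg (by linarith) hq
      linarith
    have h5 : (1 - x / 2) * (1 + x / 2) ^ 2 ≤ (1 - x / 2) * Real.exp x :=
      mul_le_mul_of_nonneg_left h2 (by linarith)
    linarith
  have hx : x / 2 ≤ 1 - Real.exp (-x) := by
    have e : Real.exp (-x) = 1 / Real.exp x := by rw [Real.exp_neg, one_div]
    rw [e, le_sub_comm, div_le_iff₀ hpos]
    linarith
  linarith [Real.sqrt_le_sqrt hx]

end Probability

/-! ## §2 Volume-preserving involutions: the fluctuation relation supplies the entropy -/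

section Involutive

variable {X : Type*} [MeasurableSpace X] {μ : Measure X}

/-- `(−ΔH) e^{−ΔH} e^{−H} ∈ L¹` whenever `ΔH e^{−H} ∈ L¹`: it is `(ΔH e^{−H}) ∘ Ψ` and `Ψ` preserves `μ`. -/
theorem integrable_deltaH_tilted {H : X → ℝ} {Ψ : X → X} (hH : Measurable H) (hΨm : Measurable Ψ)
    (hΨi : Function.Involutive Ψ) (hΨμ : MeasurePreserving Ψ μ μ)
    (hΔ : Integrable (fun z => deltaH H Ψ z * Real.exp (-H z)) μ) :
    Integrable (fun z => -deltaH H Ψ z * Real.exp (-deltaH H Ψ z) * Real.exp (-H z)) μ := by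
  have hΔm : Measurable (deltaH H Ψ) := measurable_deltaH hH hΨm
  have hwm : Measurable fun z => Real.exp (-H z) := Real.measurable_exp.comp hH.neg
  have h := (hΨμ.integrable_comp (hΔm.mul hwm).aestronglyMeasurable).mpr hΔ
  refine h.congr (Eventually.of_forall fun z => ?_)
  show deltaH H Ψ (Ψ z) * Real.exp (-H (Ψ z)) = -deltaH H Ψ z * Real.exp (-deltaH H Ψ z) * Real.exp (-H z)
  rw [deltaH_apply_involutive hΨi, mul_assoc, exp_neg_deltaH_mul_exp_neg]

/-- **The fluctuation relation at `g = id`**: `∫ (−ΔH) e^{−ΔH} e^{−H} = ∫ ΔH e^{−H}` — the relative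
entropy of the tilted law `e^{−ΔH} e^{−H}/Z = (Ψ_* π)` from `π` equals the mean energy violation. -/
theorem integral_deltaH_tilted {H : X → ℝ} {Ψ : X → X} (hΨm : Measurable Ψ)
    (hΨi : Function.Involutive Ψ) (hΨμ : MeasurePreserving Ψ μ μ) :
    ∫ z, -deltaH H Ψ z * Real.exp (-deltaH H Ψ z) * Real.exp (-H z) ∂μ
      = ∫ z, deltaH H Ψ z * Real.exp (-H z) ∂μ := by
  have h := integral_comp_deltaH_eq (H := H) hΨm hΨi hΨμ (fun x => x)
  simpa using h.symm

/-- **PINSKER'S MODEL-FREE ACCEPTANCE FLOOR FOR EVERY VOLUME-PRESERVING REVERSIBLE PROPOSAL**: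
`Ψ` a measurable `μ`-preserving involution, weight `e^{−H}` integrable with `Z > 0`,
`ΔH e^{−H} ∈ L¹`.  Then `∫ min(1, e^{−ΔH}) e^{−H} dμ ≥ (1 − √(⟨ΔH⟩/2)) · Z`,
`⟨ΔH⟩ = Z⁻¹ ∫ ΔH e^{−H} dμ`. -/
theorem involutive_acceptance_ge_pinsker {H : X → ℝ} {Ψ : X → X} (hH : Measurable H)
    (hΨm : Measurable Ψ) (hΨi : Function.Involutive Ψ) (hΨμ : MeasurePreserving Ψ μ μ)
    (hw : Integrable (fun z => Real.exp (-H z)) μ)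
    (hΔ : Integrable (fun z => deltaH H Ψ z * Real.exp (-H z)) μ) (hZ : 0 < ∫ z, Real.exp (-H z) ∂μ) :
    (1 - Real.sqrt (((∫ z, deltaH H Ψ z * Real.exp (-H z) ∂μ) / ∫ z, Real.exp (-H z) ∂μ) / 2))
        * ∫ z, Real.exp (-H z) ∂μ
      ≤ ∫ z, min 1 (Real.exp (-deltaH H Ψ z)) * Real.exp (-H z) ∂μ := by
  set Z := ∫ z, Real.exp (-H z) ∂μ with hZdef
  have hΔm : Measurable (deltaH H Ψ) := measurable_deltaH hH hΨm
  have hwm : Measurable fun z => Real.exp (-H z) := Real.measurable_exp.comp hH.neg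
  -- the Gibbs probability measure `ν = Z⁻¹ e^{−H} μ` (as in `involutive_acceptance_ge`)
  set ν : Measure X := μ.withDensity fun z => ENNReal.ofReal (Real.exp (-H z) / Z) with hν
  have hdens_m : Measurable fun z => ENNReal.ofReal (Real.exp (-H z) / Z) :=
    (hwm.div_const Z).ennreal_ofReal
  haveI : IsProbabilityMeasure ν := by
    refine ⟨?_⟩
    rw [hν, withDensity_apply _ MeasurableSet.univ, Measure.restrict_univ,
      ← ofReal_integral_eq_lintegral_ofReal (hw.div_const Z)
        (Eventually.of_forall fun z => div_nonneg (Real.exp_pos _).le hZ.le),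
      integral_div, div_self hZ.ne', ENNReal.ofReal_one]
  have hint : ∀ f : X → ℝ, ∫ z, f z ∂ν = (∫ z, f z * Real.exp (-H z) ∂μ) / Z := by
    intro f
    rw [hν, integral_withDensity_eq_integral_toReal_smul hdens_m
      (Eventually.of_forall fun _ => ENNReal.ofReal_lt_top), ← integral_div]
    refine integral_congr_ae (Eventually.of_forall fun z => ?_)
    dsimp only
    rw [ENNReal.toReal_ofReal (div_nonneg (Real.exp_pos _).le hZ.le), smul_eq_mul]
    ring
  have hintegrable : ∀ f : X → ℝ,
      Integrable (fun z => f z * Real.exp (-H z)) μ → Integrable f ν := by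
    intro f hf
    rw [hν, integrable_withDensity_iff_integrable_smul' hdens_m
      (Eventually.of_forall fun _ => ENNReal.ofReal_lt_top)]
    have e : (fun z => (ENNReal.ofReal (Real.exp (-H z) / Z)).toReal • f z)
        = fun z => Z⁻¹ * (f z * Real.exp (-H z)) := by
      funext z
      rw [ENNReal.toReal_ofReal (div_nonneg (Real.exp_pos _).le hZ.le), smul_eq_mul]
      ring
    rw [e]
    exact hf.const_mul _
  have hE : Integrable (fun z => Real.exp (-deltaH H Ψ z)) ν := by
    refine hintegrable _ ?_
    simp_rw [exp_neg_deltaH_mul_exp_neg H Ψ]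
    exact (hΨμ.integrable_comp hw.aestronglyMeasurable).mpr hw |>.congr
      (Eventually.of_forall fun z => rfl)
  have hDE : Integrable (fun z => -deltaH H Ψ z * Real.exp (-deltaH H Ψ z)) ν :=
    hintegrable _ (integrable_deltaH_tilted hH hΨm hΨi hΨμ hΔ)
  have hcreutz : ∫ z, Real.exp (-deltaH H Ψ z) ∂ν = 1 := by
    rw [hint, creutz_integral hΨm hΨi hΨμ, div_self hZ.ne']
  have h := one_sub_acceptance_le_sqrt_half_tilted (ν := ν) hΔm hE hDE hcreutz
  rw [hint (fun z => min 1 (Real.exp (-deltaH H Ψ z))),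
    hint (fun z => -deltaH H Ψ z * Real.exp (-deltaH H Ψ z)),
    integral_deltaH_tilted hΨm hΨi hΨμ] at h
  have h2 : 1 - Real.sqrt (((∫ z, deltaH H Ψ z * Real.exp (-H z) ∂μ) / Z) / 2)
      ≤ (∫ z, min 1 (Real.exp (-deltaH H Ψ z)) * Real.exp (-H z) ∂μ) / Z := by linarith
  exact (le_div_iff₀ hZ).1 h2

end Involutive

/-! ## §3 Row 2's lattice HMC -/

section Lattice

open Summit.Ventures.LatticeQCDFlow.Scoring

variable {n : ℕ}

/-- **PINSKER'S ACCEPTANCE FLOOR FOR ROW 2'S HMC, UNCONDITIONALLY** (coercive action, every step size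
`δ` and trajectory length `N`): `∫ min(1, e^{−ΔH}) e^{−H} ≥ (1 − √(⟨ΔH⟩/2)) · Z`,
`⟨ΔH⟩ = Z⁻¹ ∫ ΔH e^{−H}` (the first moment exists by `Phi4HMCEnergyViolationIntegrable`). -/
theorem hmc_acceptance_ge_pinsker {J : Fin (n + 1) → Fin (n + 1) → ℝ} {lam ε K : ℝ} (hε : 0 < ε)
    (hS : ∀ φ : Fin (n + 1) → ℝ, ε * ∑ w, φ w ^ 2 - K ≤ latticePhi4Action J lam φ)
    (δ : ℝ) (N : ℕ) :
    (1 - Real.sqrt (((∫ z, hmcDeltaH J lam δ N z * Real.exp (-phi4HmcEnergy J lam z)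
        ∂((volume : Measure (Fin (n + 1) → ℝ)).prod volume))
        / ∫ z, Real.exp (-phi4HmcEnergy J lam z) ∂((volume : Measure (Fin (n + 1) → ℝ)).prod volume))
        / 2))
      * ∫ z, Real.exp (-phi4HmcEnergy J lam z) ∂((volume : Measure (Fin (n + 1) → ℝ)).prod volume)
      ≤ ∫ z, min 1 (Real.exp (-hmcDeltaH J lam δ N z)) * Real.exp (-phi4HmcEnergy J lam z)
          ∂((volume : Measure (Fin (n + 1) → ℝ)).prod volume) :=
  involutive_acceptance_ge_pinsker (measurable_phi4HmcEnergy J lam) (measurable_hmcProposal J lam δ N)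
    (hmcProposal_involutive J lam δ N) (measurePreserving_hmcProposal J lam δ N)
    (integrable_exp_neg_phi4HmcEnergy hε hS) (integrable_hmcDeltaH_mul_exp_neg hε hS δ N)
    (integral_exp_pos (integrable_exp_neg_phi4HmcEnergy hε hS))

/-- **Every `λ > 0`, every real `J`, every `δ`, `N`.** -/
theorem hmc_acceptance_ge_pinsker_phi4 {lam : ℝ} (hlam : 0 < lam)
    (J : Fin (n + 1) → Fin (n + 1) → ℝ) (δ : ℝ) (N : ℕ) :
    (1 - Real.sqrt (((∫ z, hmcDeltaH J lam δ N z * Real.exp (-phi4HmcEnergy J lam z)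
        ∂((volume : Measure (Fin (n + 1) → ℝ)).prod volume))
        / ∫ z, Real.exp (-phi4HmcEnergy J lam z) ∂((volume : Measure (Fin (n + 1) → ℝ)).prod volume))
        / 2))
      * ∫ z, Real.exp (-phi4HmcEnergy J lam z) ∂((volume : Measure (Fin (n + 1) → ℝ)).prod volume)
      ≤ ∫ z, min 1 (Real.exp (-hmcDeltaH J lam δ N z)) * Real.exp (-phi4HmcEnergy J lam z)
          ∂((volume : Measure (Fin (n + 1) → ℝ)).prod volume) :=
  hmc_acceptance_ge_pinsker one_pos (latticePhi4Action_coercive hlam J) δ N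

end Lattice

end Summit.Ventures.LatticeQCDFlow.Exactness
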